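/-
Origin: expansion seat `planner-pub-hodgecm-toy2-g7-0`, handover #3 HANDOVER 2026-08-18T13:17:53Z (l.3882) md5 4ad8506a; rewrite Toy2g7.PullbackMod (packager row: handed in STATUS without a t30 kit row; RUN 30 addendum) (`HOME/pub-hodgecm-toy2-g7/lean/Toy2g7/InertAtom.lean`, md5 4ad8506a, 183 lines);
landed by the gen-8 packager in gate run 30 as `HodgeCM/Model/Toy/InertAtom.lean` (import ^import Toy2g7\.PullbackMod[ \t]*$→import HodgeCM.Model.Toy.PullbackMod ×1).
-/
/-
Origin: CONSISTENCY seat 2 gen 7 `planner-pub-hodgecm-toy2-g7-0` (unit `pub-hodgecm-toy2-g7`), WIP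
`HOME/pub-hodgecm-toy2-g7/lean/Toy2g7/InertAtom.lean`; intended target `HodgeCM/Model/Toy/InertAtom.lean` (new leaf).
-/
import Mathlib
import Summits.HodgeConjecture.HodgeCM.Model.ToyG2.Universe3
import Summits.HodgeConjecture.HodgeCM.Model.Toy.PullbackMod

/-!
# Inert CM atoms in the generation-2 toy universe

Load-bearing census of `COR_CM_of_descentFactsB₄`, binder F4 (continued from `PullbackMod`): the pullback-family
modifier `U♭` refutes `HC_CM` as soon as `U` contains a CM variety that is **inert** in codimension `3`
(`Universe.Inert`).  Here we reduce inertness of the one-atom CM object `A_{(K,Φ)}` of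
`toyModel3With D T pl` (in particular of `toyUniverse₃ d t`) to a property of the single atom:

* `Obj.H1Rigid A` — every Hodge map `L Y → L A` from a lattice of smaller rank vanishes (this holds when the rational
  Hodge structure `H¹(A)` is SIMPLE, e.g. for a primitive CM type; it is NOT proved here for any concrete `(K,Φ)`);
* `lin_eq_zero_of_h1Rigid` — if `A_{(K,Φ)}` is `H1Rigid` then every morphism `A_{(K,Φ)} ⟶ Y` of the generation-2
  universe with `2·dim Y + 1 < [K:ℚ]` has ZERO `H¹`-pull-back: block leaves of `Y` are killed by block-admissibility
  (`A_{(K,Φ)}` carries no block), atom leaves by rigidity (an atom leaf of `Y` has rank `≤ 2 dim Y`);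
* `inert_cm_of_h1Rigid` — hence `A_{(K,Φ)}` is inert in every codimension `p ≥ 1` with `2p + 5 ≤ [K:ℚ]`.

Generic plumbing proved on the way: maps out of an expansion are determined on the leaves (`incl_ext`), the leaf
inclusions are Hodge (`isHodge_incl`), `⋀ᵏ 0 = 0` for `k ≥ 1`.
All proofs kernel-checked; nothing is cited.
-/

noncomputable section

namespace HodgeCM.Toy

open Literature.AlgebraicGeometry.Motives
open scoped TensorProduct
open exteriorPower

/-! ### Generic lemmas on gen-1 objects -/

section Generic

variable {R : Type*} [CommRing R] {M N : Type*} [AddCommGroup M] [Module R M] [AddCommGroup N] [Module R N]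

/-- `⋀ᵏ` of the zero map is zero for `k ≥ 1`. -/
lemma map_zero_of_pos {k : ℕ} (hk : 0 < k) : map k (0 : M →ₗ[R] N) = 0 := by
  apply linearMap_ext
  refine AlternatingMap.ext fun v => ?_
  rw [LinearMap.compAlternatingMap_apply, LinearMap.compAlternatingMap_apply, map_apply_ιMulti,
    LinearMap.zero_apply]
  exact AlternatingMap.map_coord_zero (ιMulti R k) (m := ⇑(0 : M →ₗ[R] N) ∘ v) (⟨0, hk⟩ : Fin k) rfl

end Generic

namespace Obj

variable {X Y : Obj} {M : Type} [AddCommGroup M] [Module ℚ M]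

/-- linear maps out of `L (X × Y)` are determined by their restrictions along `inlL`, `inrL` -/
theorem prodL_ext {φ ψ : (X.prod Y).L →ₗ[ℚ] M} (h1 : φ ∘ₗ X.inlL Y = ψ ∘ₗ X.inlL Y)
    (h2 : φ ∘ₗ X.inrL Y = ψ ∘ₗ X.inrL Y) : φ = ψ := by
  have key : φ ∘ₗ (X.sumEquiv Y).symm.toLinearMap = ψ ∘ₗ (X.sumEquiv Y).symm.toLinearMap :=
    LinearMap.prod_ext (by simpa only [inlL, LinearMap.comp_assoc] using h1)
      (by simpa only [inrL, LinearMap.comp_assoc] using h2)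
  refine LinearMap.ext fun v => ?_
  have := LinearMap.congr_fun key (X.sumEquiv Y v)
  simpa using this

/-- **rigidity of `H¹`**: every Hodge map into `L A` from a lattice of smaller rank vanishes (true when the rational
Hodge structure `H¹(A)` is simple). -/
def H1Rigid (A : Obj) : Prop :=
  ∀ (Y : Obj) (φ : Y.L →ₗ[ℚ] A.L), IsHodge φ → Module.finrank ℚ Y.L < Module.finrank ℚ A.L → φ = 0

end Obj

end HodgeCM.Toy

namespace HodgeCM.ToyG2

open HodgeCM.Toy HodgeCM.Toy.CMPresentation
open Literature.AlgebraicGeometry.Motives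
open scoped TensorProduct
open exteriorPower Obj₂

/-! ### Leaves of an expansion -/

/-- maps out of the lattice of an expansion are determined on the leaves -/
theorem incl_ext {M : Type} [AddCommGroup M] [Module ℚ M] :
    ∀ (s : Shape) (l : s.toType → Leaf) (φ ψ : (Obj₂.expand s l).L →ₗ[ℚ] M),
      (∀ u, φ ∘ₗ Obj₂.incl s l u = ψ ∘ₗ Obj₂.incl s l u) → φ = ψ
  | .empty, l, φ, ψ, _ => by
      refine LinearMap.ext fun v => ?_
      have hv : v = 0 := funext fun e => e.elim
      rw [hv, map_zero, map_zero]
  | .unit, l, φ, ψ, h => by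
      have := h ()
      change φ ∘ₗ LinearMap.id = ψ ∘ₗ LinearMap.id at this
      simpa using this
  | .sum a b, l, φ, ψ, h => by
      refine Obj.prodL_ext ?_ ?_
      · refine incl_ext a (fun v => l (Sum.inl v)) _ _ fun u => ?_
        have := h (Sum.inl u)
        change φ ∘ₗ (Obj.inlL _ _ ∘ₗ Obj₂.incl a (fun v => l (Sum.inl v)) u) =
          ψ ∘ₗ (Obj.inlL _ _ ∘ₗ Obj₂.incl a (fun v => l (Sum.inl v)) u) at this
        rw [← LinearMap.comp_assoc, ← LinearMap.comp_assoc] at this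
        exact this
      · refine incl_ext b (fun v => l (Sum.inr v)) _ _ fun u => ?_
        have := h (Sum.inr u)
        change φ ∘ₗ (Obj.inrL _ _ ∘ₗ Obj₂.incl b (fun v => l (Sum.inr v)) u) =
          ψ ∘ₗ (Obj.inrL _ _ ∘ₗ Obj₂.incl b (fun v => l (Sum.inr v)) u) at this
        rw [← LinearMap.comp_assoc, ← LinearMap.comp_assoc] at this
        exact this

/-- a map out of `L X` vanishing on every leaf vanishes -/
theorem eq_zero_of_comp_inclAt {M : Type} [AddCommGroup M] [Module ℚ M] (X : Obj₂) (φ : X.L →ₗ[ℚ] M)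
    (h : ∀ u, φ ∘ₗ X.inclAt u = 0) : φ = 0 :=
  incl_ext X.s X.leaf φ 0 fun u => by rw [h u, LinearMap.zero_comp]

/-- the leaf inclusions are Hodge -/
theorem isHodge_incl : ∀ (s : Shape) (l : s.toType → Leaf) (u : s.toType),
    Obj.IsHodge (X := Obj₂.expand s l) (Y := (l u).obj) (Obj₂.incl s l u)
  | .empty, _, u => u.elim
  | .unit, _, _ => Obj.IsHodge.id
  | .sum a _, l, .inl u => Obj.isHodge_inlL.comp (isHodge_incl a (fun v => l (Sum.inl v)) u)
  | .sum _ b, l, .inr u => Obj.isHodge_inrL.comp (isHodge_incl b (fun v => l (Sum.inr v)) u)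

/-- (Ported verbatim from the HodgeCMPerL package; no docstring in the source.) -/
theorem isHodge_inclAt (X : Obj₂) (u : X.s.toType) :
    Obj.IsHodge (X := X.toObj) (Y := (X.leaf u).obj) (X.inclAt u) :=
  isHodge_incl X.s X.leaf u

/-- the lattice of an atom leaf has rank `2 · pdim` -/
theorem finrank_leaf_of_not_isPB (l : Leaf) (hl : ¬ l.IsPB) : Module.finrank ℚ l.obj.L = 2 * l.pdim := by
  cases l with
  | atom a =>
      have h : Module.finrank ℚ (Leaf.atom a).obj.L = Module.finrank ℚ a.F := by
        rw [Module.finrank_pi_fintype]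
        simp
      rw [h]
      show Module.finrank ℚ a.F = 2 * (Module.finrank ℚ a.F / 2)
      obtain ⟨m, hm⟩ := Atom.even_finrank a
      omega
  | pb p => exact absurd trivial hl

/-- a single leaf contributes at most `dim` -/
theorem pdim_le_dim (X : Obj₂) (u : X.s.toType) : (X.leaf u).pdim ≤ X.dim :=
  Finset.single_le_sum (f := fun u => (X.leaf u).pdim) (fun _ _ => Nat.zero_le _) (Finset.mem_univ u)

/-! ### Inert CM atoms -/

/-- **Morphisms out of a rigid CM atom into small objects have zero `H¹`-pull-back.** -/
theorem lin_eq_zero_of_h1Rigid {K : CMField} {Φ : CMType K} (hS : (cmObj K Φ).H1Rigid) {Y : Obj₂}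
    (hY : 2 * Y.dim < Module.finrank ℚ K) (f : Hom₂ (cmObj₂ K Φ) Y) : f.lin = 0 := by
  refine eq_zero_of_comp_inclAt Y f.lin fun u => ?_
  by_cases hu : (Y.leaf u).IsPB
  · rcases f.adm u hu with h0 | ⟨u', hu', -⟩
    · exact h0
    · exact absurd hu' (isBlockFree_cmObj₂ K Φ u')
  · refine hS (Y.leaf u).obj (f.lin ∘ₗ Y.inclAt u) (f.hom.hodge.comp (isHodge_inclAt Y u)) ?_
    rw [finrank_leaf_of_not_isPB _ hu, finrank_L_cmObj]
    have := pdim_le_dim Y u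
    omega

variable (D : HodgeData) (T : TraceSys) (pl : GBlocks)

/-- **A rigid CM atom is inert** in `toyModel3With D T pl`, in every codimension `p ≥ 1` with `2p + 5 ≤ [K:ℚ]`. -/
theorem inert_cm_of_h1Rigid {K : CMField} {Φ : CMType K} (hS : (cmObj K Φ).H1Rigid) {p : ℕ} (hp : 0 < p)
    (hK : 2 * p + 5 ≤ Module.finrank ℚ K) :
    (toyModel3With D T pl).Inert ((toyModel3With D T pl).cmAV K Φ) p := by
  intro Y hY f
  have hdim : (toyModel3With D T pl).dim Y = Y.X.dim := rfl
  have hf : f.lin = 0 := lin_eq_zero_of_h1Rigid hS (by omega) f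
  show map (2 * p) f.lin = 0
  rw [hf]
  exact map_zero_of_pos (by omega)

set_option smartUnfolding false in
/-- the same for the one-factor CM product `cmProd K (fun _ => Φ)` (which is `cmAV K Φ` by `rfl`) -/
theorem inert_cmProd_of_h1Rigid {K : CMField} {Φ : CMType K} (hS : (cmObj K Φ).H1Rigid) {p : ℕ} (hp : 0 < p)
    (hK : 2 * p + 5 ≤ Module.finrank ℚ K) :
    (toyModel3With D T pl).Inert ((toyModel3With D T pl).cmProd K (fun _ : Fin (0 + 1) => Φ)) p :=
  inert_cm_of_h1Rigid D T pl hS hp hK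

end HodgeCM.ToyG2

end
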